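import Summits.ResolutionOfSingularities.ResolutionOfSingularities.Theorems.MarkedTransferCampaignW21ChainWitnessSeries
import HarnessLib

/-!
# [OURS · L1 W2.1] The TWO-LEVEL chain witness (data): the standard expressions of `ε₀` (`e = 2`) and `ε₁` (`e = 1`) in
# `𝔽_p⟦y, u, v⟧`, their top frontiers, `Standing`, cases, `MinDegreeTop` at level 0, and the Case-(I) values
# `H♭(ε₀) = ε₀ + v^{p³+2p²+p}`, `H♭(ε₁) = ε₁` (every prime `p`)

Cell res-hironaka, RESCUE-SEED L-G2, slot W2.1 (USE half), seat res-L1-s21-pv-1 (gen 2); series and chain identities in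
`MarkedTransferCampaignW21ChainWitnessSeries.lean`, consequences in `…ChainCentre.lean`. Level 0 (`q = p²`, depth `4`): triples
`{((p−1,1,0); (p−1,0,0); (0,1,1)), ((p−1,1,0); (p−1,0,0); (0,0,2)), (0; (0,0,1); (0,1,p+1))}`, coefficients `1`; top pair
`((p−1,1,0), (p−1,0,0))` (`|α+pβ| = p² = q`: NOT Case (II)), top block `{γ₀ = (0,1,1) >lex γ₁ = (0,0,2)}`, Case (I),
`MinDegreeTop` (`|α+pβ+qγ₀| = 3p² = ord ε₀`). Level 1 (`q = p`): the single triple `((0,0,1); 0; (0,0,p+2))`, coefficient `−1`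
(a unit in `ρ⁴`), Case (I), and `H♭(ε₁) = (−1)⁻¹ ∂^{(0,0,1)}ε₁ · ∂^{(0,0,p²+2p)}ε₁ = ε₁` (so `h₁ = ε₁`, `g(2) = y`, `∇ = V(y)`).
OURS / folklore about OURS data; nothing here is a statement of or about the manuscript; AI review is weaker than expert review.
-/

noncomputable section

set_option linter.dupNamespace false -- mandated namespace of this single-conjunct summit

namespace Summit.ResolutionOfSingularities.ResolutionOfSingularities.Theorems

namespace CampaignW21

open Literature.AlgebraicGeometry.Hironaka2017.S08UnitMonomial
open Literature.AlgebraicGeometry.Hironaka2017.S09LLUED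
open Literature.AlgebraicGeometry.Hironaka2017.S09LLUED.TopFrontier
open Literature.AlgebraicGeometry.Resolution
open Literature.RingTheory.MvPowerSeries
open MvPowerSeries Finsupp

namespace ChainWitness

open AlongCentreWitness

variable (p : ℕ) [hp : Fact p.Prime]

/-! ### Level 0: the standard expression of `ε₀` with `e = 2` -/
/-- The level-0 triples `a₁, a₂, a₃` and support `T0`. [folklore] -/
def a₁ : ExpTriple 3 := (e3 (p - 1) 1 0, e3 (p - 1) 0 0, e3 0 1 1)
/-- [folklore] -/
def a₂ : ExpTriple 3 := (e3 (p - 1) 1 0, e3 (p - 1) 0 0, e3 0 0 2)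
/-- [folklore] -/
def a₃ : ExpTriple 3 := (0, e3 0 0 1, e3 0 1 (p + 1))
/-- [folklore] -/
def T0 : Finset (ExpTriple 3) := {a₁ p, a₂ p, a₃ p}

omit hp in
/-- [folklore] -/
theorem a₁_ne_a₂ : a₁ p ≠ a₂ p := fun h => by simpa [a₁, a₂, e3_apply_one] using congrArg (fun t : ExpTriple 3 => t.2.2 1) h
omit hp in
/-- [folklore] -/
theorem a₁_ne_a₃ : a₁ p ≠ a₃ p := fun h => by simpa [a₁, a₃, e3_apply_one] using congrArg (fun t : ExpTriple 3 => t.1 1) h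
omit hp in
/-- [folklore] -/
theorem a₂_ne_a₃ : a₂ p ≠ a₃ p := fun h => by simpa [a₂, a₃, e3_apply_one] using congrArg (fun t : ExpTriple 3 => t.1 1) h
omit hp in
/-- [folklore] -/
theorem mem_T0 {t : ExpTriple 3} : t ∈ T0 p ↔ t = a₁ p ∨ t = a₂ p ∨ t = a₃ p := by simp [T0]
/-- [folklore] -/
theorem effSupport_T0 : effSupport (T0 p) (uu p) = T0 p := by
  ext t; simp [effSupport, uu]

/-- The key of the top pair `((p−1,1,0), (p−1,0,0))`. [folklore] -/
def K0 : Lex (Lex (Fin 3 →₀ ℕ) × Lex (Fin 3 →₀ ℕ)) := toLex (toLex (e3 (p - 1) 1 0), toLex (e3 (p - 1) 0 0))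

/-- `0 <lex (p−1, 1, 0)`. [folklore] -/
theorem toLex_zero_lt : (toLex (0 : Fin 3 →₀ ℕ) : Lex (Fin 3 →₀ ℕ)) < toLex (e3 (p - 1) 1 0) := by
  have h1 : 1 < p := hp.out.one_lt
  rw [Finsupp.Lex.lt_iff]
  refine ⟨0, fun j hj => absurd hj (Fin.not_lt_zero j), ?_⟩
  show (0 : Fin 3 →₀ ℕ) 0 < (e3 (p - 1) 1 0) 0
  rw [Finsupp.coe_zero, Pi.zero_apply, e3_apply_zero]; omega
/-- [folklore] -/
theorem pairKey_le0 (t : ExpTriple 3) (ht : t ∈ T0 p) : pairKey t ≤ K0 p := by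
  rcases (mem_T0 p).1 ht with rfl | rfl | rfl
  · exact le_rfl
  · exact le_rfl
  · exact Prod.Lex.toLex_le_toLex.2 (Or.inl (toLex_zero_lt p))

/-- [folklore] -/
theorem topPair_T0 : topPair (T0 p) (uu p) = (e3 (p - 1) 1 0, e3 (p - 1) 0 0) := by
  have h1 : a₁ p ∈ effSupport (T0 p) (uu p) := by rw [effSupport_T0]; exact (mem_T0 p).2 (Or.inl rfl)
  have hmax : ∀ h, ((effSupport (T0 p) (uu p)).image pairKey).max' h = K0 p := fun h =>
    le_antisymm (Finset.max'_le _ _ _ fun k hk => by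
        obtain ⟨t, ht, rfl⟩ := Finset.mem_image.1 hk
        exact pairKey_le0 p t (by rwa [effSupport_T0] at ht))
      (Finset.le_max' _ (K0 p) ((Finset.mem_image (f := pairKey)).2 ⟨a₁ p, h1, rfl⟩))
  unfold topPair
  rw [dif_pos ⟨a₁ p, h1⟩]
  simp only [hmax]
  rfl

/-- `α = (p−1, 1, 0)` at level 0. [folklore] -/
theorem alpha_T0 : alpha (T0 p) (uu p) = e3 (p - 1) 1 0 := by rw [alpha, topPair_T0]
/-- `β = (p−1, 0, 0)` at level 0. [folklore] -/
theorem beta_T0 : beta (T0 p) (uu p) = e3 (p - 1) 0 0 := by rw [beta, topPair_T0]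

/-- The level-0 top block. [folklore] -/
theorem topBlock_T0 : topBlock (T0 p) (uu p) = {a₁ p, a₂ p} := by
  unfold topBlock
  rw [effSupport_T0, alpha_T0, beta_T0]
  ext t
  simp only [Finset.mem_filter, mem_T0, Finset.mem_insert, Finset.mem_singleton]
  constructor
  · rintro ⟨h | h | h, h1, -⟩
    · exact Or.inl h
    · exact Or.inr h
    · exfalso; subst h
      have h' := DFunLike.congr_fun h1 1
      simp [a₃, e3_apply_one] at h'
  · rintro (rfl | rfl)
    · exact ⟨Or.inl rfl, rfl, rfl⟩
    · exact ⟨Or.inr (Or.inl rfl), rfl, rfl⟩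

/-- [folklore] -/
theorem mem_gammaKeys_T0 {k : Lex (Fin 3 →₀ ℕ)} :
    k ∈ gammaKeys (T0 p) (uu p) ↔ k = toLex (e3 0 1 1) ∨ k = toLex (e3 0 0 2) := by
  unfold gammaKeys
  rw [topBlock_T0, Finset.mem_image]
  constructor
  · rintro ⟨t, ht, rfl⟩
    simp only [Finset.mem_insert, Finset.mem_singleton] at ht
    rcases ht with rfl | rfl
    · exact Or.inl rfl
    · exact Or.inr rfl
  · rintro (rfl | rfl)
    · exact ⟨a₁ p, by simp, rfl⟩
    · exact ⟨a₂ p, by simp, rfl⟩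

/-- `m + 1 = 2` at level 0. [folklore] -/
theorem frontierLength_T0 : frontierLength (T0 p) (uu p) = 2 := by
  have : gammaKeys (T0 p) (uu p) = {toLex (e3 0 1 1), toLex (e3 0 0 2)} := by ext k; rw [mem_gammaKeys_T0]; simp
  rw [frontierLength, this]; exact Finset.card_pair toLex_e3_ne
/-- [folklore] -/
theorem frontierLength_T0_pos : 0 < frontierLength (T0 p) (uu p) := by
  rw [frontierLength_T0]; exact Nat.succ_pos 1

/-- `γ₀ = (0,1,1)` at level 0. [folklore] -/
theorem gamma_zero_T0 (h0 : 0 < frontierLength (T0 p) (uu p)) : gamma (T0 p) (uu p) ⟨0, h0⟩ = e3 0 1 1 := by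
  have hmax : ∀ h, (gammaKeys (T0 p) (uu p)).max' h = toLex (e3 0 1 1) := fun h =>
    le_antisymm (Finset.max'_le _ _ _ fun k hk => by
        rcases (mem_gammaKeys_T0 p).1 hk with rfl | rfl
        · exact le_rfl
        · exact le_of_lt toLex_e3_002_lt)
      (Finset.le_max' _ _ ((mem_gammaKeys_T0 p).2 (Or.inl rfl)))
  have key : ∀ (k : ℕ) (hk : (gammaKeys (T0 p) (uu p)).card = k) (i : Fin k), i.val = k - 1 →
      ofLex ((gammaKeys (T0 p) (uu p)).orderEmbOfFin hk i) = e3 0 1 1 := by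
    rintro k hk ⟨i, hi⟩ (h : i = k - 1)
    subst h
    rw [Finset.orderEmbOfFin_last hk (by omega), hmax]
    rfl
  exact key _ rfl _ (by simp [Fin.val_rev])

/-- **The depth-4 standard expression of `ε₀` with `e = 2`** (`q = p²`; `a_i < p`, `b_i < p`). [folklore] -/
def stdExpr0 : StandardExpression p (xs (ZMod p) 3) 2 4 (eps0 p) where
  support := T0 p
  u := uu p
  u_mem := fun _ _ => ⟨1, one_pow _⟩
  u_unit_or_zero := fun _ _ => Or.inl isUnit_one
  a_lt := by
    intro t ht i
    have h1 : 1 < p := hp.out.one_lt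
    rcases (mem_T0 p).1 ht with rfl | rfl | rfl <;> fin_cases i <;>
      simp [a₁, a₂, a₃, e3_apply_zero, e3_apply_one, e3_apply_two] <;> omega
  b_lt := by
    intro t ht j
    have h1 : 1 < p := hp.out.one_lt
    rcases (mem_T0 p).1 ht with rfl | rfl | rfl <;> fin_cases j <;>
      simp [a₁, a₂, a₃, e3_apply_zero, e3_apply_one, e3_apply_two] <;> omega
  sum_eq := by
    rw [T0, Finset.sum_insert (by simp [a₁_ne_a₂, a₁_ne_a₃]), Finset.sum_insert (by simp [a₂_ne_a₃]),
      Finset.sum_singleton]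
    simp only [Fin.prod_univ_three, a₁, a₂, a₃, xs, uu, e3_apply_zero, e3_apply_one, e3_apply_two, Finsupp.coe_zero,
      Pi.zero_apply, mul_zero, pow_zero, one_mul, mul_one, pow_one]
    simp only [eps0, M]
    ring

/-- `|α + pβ + qγ₀| = 3p²` at level 0. [folklore] -/
theorem topDegree_T0 :
    (alpha (T0 p) (uu p) + p • beta (T0 p) (uu p) + p ^ 2 • gamma (T0 p) (uu p) ⟨0, frontierLength_T0_pos p⟩).degree =
      3 * p ^ 2 := by
  rw [alpha_T0, beta_T0, gamma_zero_T0, smul_e3, smul_e3, e3_add, e3_add, e3_degree]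
  have hM := M_add_one p
  unfold M at hM
  have h1 : 1 < p := hp.out.one_lt
  nlinarith [hM]

/-- `|α + pβ| = p²` at level 0 (so the datum is NOT in Case (II)). [folklore] -/
theorem topFrontier_degree_T0 : (alpha (T0 p) (uu p) + p • beta (T0 p) (uu p)).degree = p ^ 2 := by
  rw [alpha_T0, beta_T0, smul_e3, e3_add, e3_degree]
  have hM := M_add_one p
  unfold M at hM
  omega

/-- The level-0 `Standing` binders (`u₀ = 1`, `α ≠ 0`, `ord ε₀ = 3p² > p²`, `|α+pβ+qγ₀| = 3p² < p⁴`). [folklore] -/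
theorem standing0 : Standing p 2 4 (eps0 p) (stdExpr0 p) (frontierLength_T0_pos p) where
  unit_u0 := isUnit_one
  alpha_ne := by
    intro h
    have h' := DFunLike.congr_fun (show alpha (T0 p) (uu p) = 0 from h) 1
    rw [alpha_T0, e3_apply_one] at h'
    exact one_ne_zero h'
  ord_lt := by
    show ((p ^ 2 : ℕ) : ℕ∞) < adicOrder (eps0 p)
    rw [adicOrder_eps0]
    have h1 : 1 < p := hp.out.one_lt
    exact_mod_cast (show p ^ 2 < 3 * p ^ 2 by nlinarith)
  depth := by
    show (alpha (T0 p) (uu p) + p • beta (T0 p) (uu p) + p ^ 2 • gamma (T0 p) (uu p) ⟨0, frontierLength_T0_pos p⟩).degree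
      < p ^ 4
    rw [topDegree_T0]
    have h2 : 2 ≤ p := hp.out.two_le
    have h4 : 4 ≤ p ^ 2 := by nlinarith
    nlinarith

/-- Case (I) at level 0: `|qγ₀| = 2p² ≥ 2q`. [folklore] -/
theorem isCaseI0 : IsCaseI (p ^ 2) (gamma (T0 p) (uu p) ⟨0, frontierLength_T0_pos p⟩) := by
  show 2 * p ^ 2 ≤ (p ^ 2 • gamma (T0 p) (uu p) ⟨0, frontierLength_T0_pos p⟩).degree
  rw [gamma_zero_T0, smul_e3, e3_degree]
  omega

/-- NOT Case (II) at level 0: `|α + pβ| = p² = q`. [folklore] -/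
theorem not_isCaseII0 : ¬ IsCaseII p (p ^ 2) (alpha (T0 p) (uu p)) (beta (T0 p) (uu p)) := by
  show ¬ p ^ 2 < (alpha (T0 p) (uu p) + p • beta (T0 p) (uu p)).degree
  rw [topFrontier_degree_T0]; exact lt_irrefl _

/-- NOT Case (III) at level 0: `|qγ₀| = 2p² ≠ q`. [folklore] -/
theorem not_isCaseIII0 :
    ¬ IsCaseIII p (p ^ 2) (alpha (T0 p) (uu p)) (beta (T0 p) (uu p)) (gamma (T0 p) (uu p) ⟨0, frontierLength_T0_pos p⟩) := by
  rintro ⟨-, -, h, -⟩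
  rw [gamma_zero_T0, smul_e3, e3_degree] at h
  have h1 : 1 < p := hp.out.one_lt
  have : 0 < p ^ 2 := by positivity
  omega

/-- **Level 0 lies in `MinDegreeTop`** (`|α+pβ+qγ₀| = 3p² = ord ε₀`): the bound AT `ξ` holds (`orderBoundMinDegreeTop_holds`).
[folklore] -/
theorem minDegreeTop0 : MinDegreeTop p 2 (eps0 p) (stdExpr0 p) := by
  intro h0
  show adicOrder (eps0 p) =
    ((alpha (T0 p) (uu p) + p • beta (T0 p) (uu p) + p ^ 2 • gamma (T0 p) (uu p) ⟨0, h0⟩).degree : ℕ∞)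
  rw [topDegree_T0, adicOrder_eps0]

/-- The level-0 Case-(I) value is `∂^{(p²−1,1,0)}ε₀ · ∂^{(0,p²,p²)}ε₀` (leading unit `1`). [folklore] -/
theorem caseI_eq0 (u : (R p)ˣ) (hu : (u : R p) = 1) :
    HFlat.caseI (hasseD (ZMod p) 3) u p (p ^ 2) (alpha (T0 p) (uu p)) (beta (T0 p) (uu p))
        (gamma (T0 p) (uu p) ⟨0, frontierLength_T0_pos p⟩) (eps0 p) =
      hasseDeriv (e3 (M p) 1 0) (eps0 p) * hasseDeriv (e3 0 (p ^ 2) (p ^ 2)) (eps0 p) := by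
  obtain rfl : u = 1 := Units.ext (by simpa using hu)
  show (↑(1 : (R p)ˣ)⁻¹ : R p) * hasseDeriv (alpha (T0 p) (uu p) + p • beta (T0 p) (uu p)) (eps0 p) *
      hasseDeriv (p ^ 2 • gamma (T0 p) (uu p) ⟨0, frontierLength_T0_pos p⟩) (eps0 p) = _
  rw [inv_one, Units.val_one, one_mul, alpha_T0, beta_T0, gamma_zero_T0, smul_e3, smul_e3, e3_add, mul_zero, mul_zero,
    mul_one, add_zero, add_zero]
  rfl

/-- **`H♭(ε₀) = ε₀ + v^{p³+2p²+p}` at level 0.** [folklore] -/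
theorem caseI_eq0_add (u : (R p)ˣ) (hu : (u : R p) = 1) :
    HFlat.caseI (hasseD (ZMod p) 3) u p (p ^ 2) (alpha (T0 p) (uu p)) (beta (T0 p) (uu p))
        (gamma (T0 p) (uu p) ⟨0, frontierLength_T0_pos p⟩) (eps0 p) =
      eps0 p + (X 2 : R p) ^ (p ^ 3 + 2 * p ^ 2 + p) := by
  rw [caseI_eq0 p u hu, hd_prod0, X2_pow_eq]

/-! ### Level 1: the standard expression of `ε₁ = −v^{(p+1)²}` with `e = 1` -/
/-- The single level-1 triple `((0,0,1); 0; (0,0,p+2))`, support `T1`, coefficient `un = −1`. [folklore] -/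
def b₁ : ExpTriple 3 := (e3 0 0 1, 0, e3 0 0 (p + 2))
/-- [folklore] -/
def T1 : Finset (ExpTriple 3) := {b₁ p}
/-- [folklore] -/
def un : ExpTriple 3 → R p := fun _ => -1
/-- [folklore] -/
theorem effSupport_T1 : effSupport (T1 p) (un p) = T1 p := by
  ext t; simp [effSupport, un]

/-- [folklore] -/
theorem topPair_T1 : topPair (T1 p) (un p) = (e3 0 0 1, 0) := by
  have h1 : b₁ p ∈ effSupport (T1 p) (un p) := by rw [effSupport_T1]; simp [T1]
  have himg : (effSupport (T1 p) (un p)).image pairKey = {pairKey (b₁ p)} := by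
    rw [effSupport_T1, T1, Finset.image_singleton]
  unfold topPair
  rw [dif_pos ⟨b₁ p, h1⟩]
  simp only [himg, Finset.max'_singleton]
  rfl

/-- `α = (0,0,1)`, `β = 0` at level 1. [folklore] -/
theorem alpha_T1 : alpha (T1 p) (un p) = e3 0 0 1 := by rw [alpha, topPair_T1]
/-- [folklore] -/
theorem beta_T1 : beta (T1 p) (un p) = 0 := by rw [beta, topPair_T1]

/-- [folklore] -/
theorem topBlock_T1 : topBlock (T1 p) (un p) = {b₁ p} := by
  unfold topBlock
  rw [effSupport_T1, alpha_T1, beta_T1]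
  ext t
  simp only [Finset.mem_filter, T1, Finset.mem_singleton]
  constructor
  · rintro ⟨h, -, -⟩; exact h
  · rintro rfl; exact ⟨rfl, rfl, rfl⟩

/-- [folklore] -/
theorem frontierLength_T1 : frontierLength (T1 p) (un p) = 1 := by
  unfold frontierLength gammaKeys
  rw [topBlock_T1, Finset.image_singleton, Finset.card_singleton]
/-- [folklore] -/
theorem frontierLength_T1_pos : 0 < frontierLength (T1 p) (un p) := by
  rw [frontierLength_T1]; exact Nat.one_pos

/-- [folklore] -/
theorem mem_gammaKeys_T1 {k : Lex (Fin 3 →₀ ℕ)} : k ∈ gammaKeys (T1 p) (un p) ↔ k = toLex (e3 0 0 (p + 2)) := by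
  unfold gammaKeys
  rw [topBlock_T1, Finset.image_singleton, Finset.mem_singleton]
  exact Iff.rfl

/-- `γ₀ = (0,0,p+2)` at level 1. [folklore] -/
theorem gamma_T1 (j : Fin (frontierLength (T1 p) (un p))) : gamma (T1 p) (un p) j = e3 0 0 (p + 2) := by
  have hm := Finset.orderEmbOfFin_mem (gammaKeys (T1 p) (un p)) rfl (Fin.rev j)
  rw [mem_gammaKeys_T1] at hm
  show ofLex ((gammaKeys (T1 p) (un p)).orderEmbOfFin rfl (Fin.rev j)) = e3 0 0 (p + 2)
  rw [hm]; rfl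

/-- **The depth-4 standard expression of `ε₁` with `e = 1`** (coefficient `−1 = (−1)^{p⁴} ∈ ρ⁴`, a unit). [folklore] -/
def stdExpr1 : StandardExpression p (xs (ZMod p) 3) 1 4 (eps1 p) where
  support := T1 p
  u := un p
  u_mem := fun _ _ => by
    haveI : CharP (R p) p := charP_R p
    exact ⟨-1, neg_one_pow_char_pow (R p) p 4⟩
  u_unit_or_zero := fun _ _ => Or.inl isUnit_one.neg
  a_lt := by
    intro t ht i
    have h1 : 1 < p := hp.out.one_lt
    simp only [T1, Finset.mem_singleton] at ht
    subst ht
    fin_cases i <;> simp [b₁, e3_apply_zero, e3_apply_one, e3_apply_two] <;> omega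
  b_lt := by
    intro t ht j
    simp only [T1, Finset.mem_singleton] at ht
    subst ht
    fin_cases j <;> simp [b₁]
  sum_eq := by
    rw [T1, Finset.sum_singleton]
    simp only [Fin.prod_univ_three, b₁, xs, un, e3_apply_zero, e3_apply_one, e3_apply_two, Finsupp.coe_zero,
      Pi.zero_apply, mul_zero, pow_zero, one_mul, pow_one]
    simp only [eps1]
    ring

/-- The level-1 `Standing` binders (`u₀ = −1` a unit, `α ≠ 0`, `ord ε₁ = (p+1)² > p`, `|α+pβ+qγ₀| = (p+1)² < p⁴`).
[folklore] -/
theorem standing1 : Standing p 1 4 (eps1 p) (stdExpr1 p) (frontierLength_T1_pos p) where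
  unit_u0 := isUnit_one.neg
  alpha_ne := by
    intro h
    have h' := DFunLike.congr_fun (show alpha (T1 p) (un p) = 0 from h) 2
    rw [alpha_T1, e3_apply_two] at h'
    exact one_ne_zero h'
  ord_lt := by
    show ((p ^ 1 : ℕ) : ℕ∞) < adicOrder (eps1 p)
    rw [pow_one, adicOrder_eps1]
    exact_mod_cast (show p < p ^ 2 + 2 * p + 1 by nlinarith)
  depth := by
    show (alpha (T1 p) (un p) + p • beta (T1 p) (un p) + p ^ 1 • gamma (T1 p) (un p) ⟨0, frontierLength_T1_pos p⟩).degree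
      < p ^ 4
    rw [alpha_T1, beta_T1, gamma_T1, smul_zero, add_zero, pow_one, smul_e3, e3_add, e3_degree]
    have h2 : 2 ≤ p := hp.out.two_le
    have h4 : 4 ≤ p ^ 2 := by nlinarith
    nlinarith

/-- Case (I) at level 1: `|qγ₀| = p(p+2) ≥ 2q`. [folklore] -/
theorem isCaseI1 : IsCaseI (p ^ 1) (gamma (T1 p) (un p) ⟨0, frontierLength_T1_pos p⟩) := by
  show 2 * p ^ 1 ≤ (p ^ 1 • gamma (T1 p) (un p) ⟨0, frontierLength_T1_pos p⟩).degree
  rw [gamma_T1, pow_one, smul_e3, e3_degree]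
  nlinarith

/-- **`H♭(ε₁) = ε₁` at level 1** (`u₀ = −1`): `(−1)⁻¹ · ∂^{(0,0,1)}ε₁ · ∂^{(0,0,p²+2p)}ε₁ = (−1)(−v^{p²+2p})(−v) = ε₁`. So `h₁ = ε₁`
and the chain ends with `g(2) = y`. [folklore] -/
theorem caseI_eq1 (u : (R p)ˣ) (hu : (u : R p) = -1) :
    HFlat.caseI (hasseD (ZMod p) 3) u p (p ^ 1) (alpha (T1 p) (un p)) (beta (T1 p) (un p))
        (gamma (T1 p) (un p) ⟨0, frontierLength_T1_pos p⟩) (eps1 p) = eps1 p := by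
  have hinv : (↑u⁻¹ : R p) = -1 := Units.inv_eq_of_mul_eq_one_right (by rw [hu]; ring)
  show (↑u⁻¹ : R p) * hasseDeriv (alpha (T1 p) (un p) + p • beta (T1 p) (un p)) (eps1 p) *
      hasseDeriv (p ^ 1 • gamma (T1 p) (un p) ⟨0, frontierLength_T1_pos p⟩) (eps1 p) = _
  rw [hinv, alpha_T1, beta_T1, gamma_T1, smul_zero, add_zero, pow_one, smul_e3, mul_zero,
    show p * (p + 2) = p ^ 2 + 2 * p by ring, eps1_eq, map_neg, map_neg,
    hasseDeriv_e3_monomial_of_le p le_rfl le_rfl (by omega), hasseDeriv_e3_monomial_of_le p le_rfl le_rfl (by omega)]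
  simp only [Nat.choose_zero_right, Nat.choose_one_right, Nat.sub_zero, Nat.add_sub_cancel, Nat.add_sub_cancel_left,
    Nat.choose_succ_self_right, one_mul, mul_one, (natCast_sq_succ p).2]
  have hring : (-1 : R p) * -(monomial (e3 0 0 (p ^ 2 + 2 * p)) (1 : ZMod p)) * -(monomial (e3 0 0 1) (1 : ZMod p)) =
      -((monomial (e3 0 0 (p ^ 2 + 2 * p)) (1 : ZMod p)) * monomial (e3 0 0 1) 1) := by ring
  rw [hring, monomial_mul_monomial, e3_add, mul_one]

end ChainWitness

end CampaignW21

end Summit.ResolutionOfSingularities.ResolutionOfSingularities.Theorems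

end
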